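import Mathlib
import HarnessLib
import Summits.ValiantsHypothesis.ValiantsHypothesis.Theses.MonotoneRestoration
import Literature.Computability.AlgebraicComplexity.SymmetricCircuitScaledInputs

/-! # Route MonotoneRestoration — crux `MonotoneRestorationQP`, line Sketch, stub Z2
(stmt-ValiantsHypothesis-15886)

**Scaled inputs, symmetrically.** For a group `Γ` acting on a finite set of variables `X` and a
constant `t`, the family `(t · x)_{x ∈ X}` — outputs indexed by the `Γ`-set `X` itself — is
computed by ONE `Γ`-symmetric Dawar–Wilsenach labelled arithmetic circuit on at most `2 |X| + 1`
gates. With substitution (Z1) this is the scaling `f ↦ f(t · x)` of a symmetrically computed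
polynomial, the engine of homogeneous-component extraction in THEOREM ζ (the size calculus of
square-symmetric circuits).

Proof: the universe-`0` instance of the tree lemma `LabelledArithCircuit.exists_scaledInputs`
(`Literature/Computability/AlgebraicComplexity/SymmetricCircuitScaledInputs.lean`): gates
`inp x` (label `x`), one constant gate `cst` (label `t`) and product gates `out x` with children
`{cst, inp x}` as the outputs; `Γ` acts by `inp x ↦ inp (γ • x)`, `out x ↦ out (γ • x)`, fixing
`cst`, a bundled `SymmetricArithmeticCircuit`.
-/

noncomputable section

-- `Summit.ValiantsHypothesis.ValiantsHypothesis.…` is the tree's mandated namespace (Sub = Summit).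
set_option linter.dupNamespace false

namespace Summit.ValiantsHypothesis.ValiantsHypothesis.Theorems

open Literature.Computability.AlgebraicComplexity

/-- **Z2 — scaled inputs** (crux `MonotoneRestorationQP`, line Sketch; registered stub
`stub_symmetric_scaledInputs`): for a finite `Γ`-set of variables `X` and a constant `t`, the
family `(t · x)_{x ∈ X}` is computed at outputs indexed by `X` by a `Γ`-symmetric circuit on at
most `2 |X| + 1` gates (inputs `x`, one constant gate `t`, products `t × x`). Instance of
`LabelledArithCircuit.exists_scaledInputs`. -/
theorem stub_symmetric_scaledInputs {K X Γ : Type} [CommSemiring K] [Group Γ] [MulAction Γ X]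
    [Fintype X] [DecidableEq X] (t : K) :
    ∃ (G : Type) (_ : Fintype G) (C : LabelledArithCircuit K X X G),
      C.IsSymmetric Γ ∧
      (∀ x, C.eval (C.output x) = MvPolynomial.C t * MvPolynomial.X x) ∧
      Fintype.card G ≤ 2 * Fintype.card X + 1 :=
  LabelledArithCircuit.exists_scaledInputs Γ t

end Summit.ValiantsHypothesis.ValiantsHypothesis.Theorems

end
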